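import Literature.Geometry.Lorentzian.CurvatureRegularity
import Literature.Geometry.Lorentzian.GeodesicSpeed
import Literature.Geometry.Riemannian.IsotropicCurvature
import Mathlib.Analysis.Normed.Module.FiniteDimension
import HarnessLib

/-!
# Uniform positivity of curvature functionals on the orthonormal frames of a compact manifold

The compactness step behind "constants depending only on the initial metric" in Hamilton's
pinching estimates (Hamilton 1997, §2.1, p. 8: "Note that if `M⁴` is compact and `a₁ + a₂ > 0`
and `c₁ + c₂ > 0` at `t = 0`, there is some constant `λ` so that the estimate indeed holds at
`t = 0`"), used for Thm. B1.2 in `RicciFlowPICProofs.lean`: on a compact Riemannian manifold, a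
continuous function of the curvature components `Rm_x(e_a, e_b, e_c, e_d)` of orthonormal frames
`e` (and of a parameter in a compact set) which is positive at every orthonormal frame is bounded
below by a positive constant.

## Contents

* `curvatureForm_sum_smul` (and one-slot versions) — multilinear expansion of
  `Rm_x = curvatureForm` over finite combinations `Σ cᵢ sᵢ` (for `g_x` itself this is
  `PseudoRiemannianMetric.val_sum_smul_sum_smul`, `GeodesicSpeed.lean`).
* `continuousOn_curvatureForm_localFrame` — the components `Rm_x(sᵢ x, sⱼ x, sₖ x, sₗ x)` in the
  local frame `e.localFrame b` of a trivialization of `TM` (Mathlib) are continuous on its base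
  set, for any Levi-Civita connection of a `C^∞` metric (`contMDiffOn_curvature_apply`,
  `CurvatureRegularity.lean`; O'Neill 1983, Ch. 3, Lemma 3.35: `R` is a tensor field).
* `exists_pos_mul_norm_sq_le_val` — uniform positive-definiteness `λ ‖w‖² ≤ g_x(Σ wᵢsᵢ, Σ wᵢsᵢ)`
  of a Riemannian metric over a compact subset of the base set.
* `exists_nhds_pos_le_curvatureFunctional` (near a point), `exists_pos_le_curvatureFunctional`
  (compact `M`) — the uniform positive lower bound.

## Proof and design

Near `x₀`, frames at `x` are coefficient arrays `C` (`e_a = Σᵢ C_{ai} sᵢ x`); orthonormality is the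
closed condition `Σᵢⱼ C_{ai} C_{bj} g_x(sᵢ, sⱼ) = δ_{ab}`, and over a compact neighbourhood of `x₀`
the coefficients of orthonormal frames are bounded by the `λ`-bound, so (point, coefficients,
parameter) ranges over a compact set on which the functional is continuous and positive, hence
at least its positive minimum (`IsCompact.exists_isMinOn`); globally, a finite subcover
(`IsCompact.elim_nhds_subcover`). Frame size `ι` and parameter space are arbitrary; `M` is assumed
locally compact (`ChartedSpace.locallyCompactSpace`). No definitions are introduced.

## References

* R. S. Hamilton, *Four-manifolds with positive isotropic curvature*, Comm. Anal. Geom. 5 (1997)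
  1–92, §2.1, p. 8. [Hamilton1997]
* B. O'Neill, *Semi-Riemannian geometry with applications to relativity*, Academic Press 1983,
  Ch. 3, Lemma 3.35. [ONeill1983]
-/

noncomputable section

open Bundle Set Function Filter
open scoped Manifold ContDiff Topology BigOperators

namespace Literature.Geometry.Riemannian

open Lorentzian Lorentzian.PseudoRiemannianMetric

variable {E : Type*} [NormedAddCommGroup E] [NormedSpace ℝ E] {H : Type*} [TopologicalSpace H]
  {I : ModelWithCorners ℝ E H} {M : Type*} [TopologicalSpace M] [ChartedSpace H M]
  [IsManifold I ∞ M] {n : ℕ∞ω}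
  {g : PseudoRiemannianMetric I n E (TangentSpace I : M → Type _)}
  {cov : CovariantDerivative I E (TangentSpace I : M → Type _)}

/-! ### Multilinear expansion in a family of vectors -/

section Algebra

variable {κ : Type*} [Fintype κ]

/-- Linearity of `Rm_x = curvatureForm` in its first slot over a finite combination. [folklore] -/
theorem curvatureForm_sum_smul₁ (x : M) (s : κ → TangentSpace I x) (a : κ → ℝ)
    (Y Z W : TangentSpace I x) :
    g.curvatureForm cov x (∑ i, a i • s i) Y Z W = ∑ i, a i * g.curvatureForm cov x (s i) Y Z W := by
  simp only [curvatureForm, map_sum, map_smul, _root_.sum_apply,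
    _root_.smul_apply, smul_eq_mul]

/-- Linearity of `curvatureForm` in its second slot over a finite combination. [folklore] -/
theorem curvatureForm_sum_smul₂ (x : M) (s : κ → TangentSpace I x) (b : κ → ℝ)
    (X Z W : TangentSpace I x) :
    g.curvatureForm cov x X (∑ j, b j • s j) Z W = ∑ j, b j * g.curvatureForm cov x X (s j) Z W := by
  simp only [curvatureForm, map_sum, map_smul, _root_.sum_apply,
    _root_.smul_apply, smul_eq_mul]

/-- Linearity of `curvatureForm` in its third slot over a finite combination. [folklore] -/
theorem curvatureForm_sum_smul₃ (x : M) (s : κ → TangentSpace I x) (c : κ → ℝ)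
    (X Y W : TangentSpace I x) :
    g.curvatureForm cov x X Y (∑ k, c k • s k) W = ∑ k, c k * g.curvatureForm cov x X Y (s k) W := by
  simp only [curvatureForm, map_sum, map_smul, _root_.sum_apply,
    _root_.smul_apply, smul_eq_mul]

/-- Linearity of `curvatureForm` in its fourth slot over a finite combination. [folklore] -/
theorem curvatureForm_sum_smul₄ (x : M) (s : κ → TangentSpace I x) (d : κ → ℝ)
    (X Y Z : TangentSpace I x) :
    g.curvatureForm cov x X Y Z (∑ l, d l • s l) = ∑ l, d l * g.curvatureForm cov x X Y Z (s l) := by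
  simp only [curvatureForm, map_sum, map_smul, smul_eq_mul]

/-- `Rm_x(Σ aᵢsᵢ, Σ bⱼsⱼ, Σ cₖsₖ, Σ dₗsₗ) = Σ aᵢbⱼcₖdₗ Rm_x(sᵢ,sⱼ,sₖ,sₗ)` (multilinearity of the
covariant curvature tensor `curvatureForm`). [folklore] -/
theorem curvatureForm_sum_smul (x : M) (s : κ → TangentSpace I x) (a b c d : κ → ℝ) :
    g.curvatureForm cov x (∑ i, a i • s i) (∑ j, b j • s j) (∑ k, c k • s k) (∑ l, d l • s l) =
      ∑ i, ∑ j, ∑ k, ∑ l,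
        a i * b j * c k * d l * g.curvatureForm cov x (s i) (s j) (s k) (s l) := by
  rw [curvatureForm_sum_smul₁]
  refine Finset.sum_congr rfl fun i _ ↦ ?_
  rw [curvatureForm_sum_smul₂, Finset.mul_sum]
  refine Finset.sum_congr rfl fun j _ ↦ ?_
  rw [curvatureForm_sum_smul₃, Finset.mul_sum, Finset.mul_sum]
  refine Finset.sum_congr rfl fun k _ ↦ ?_
  rw [curvatureForm_sum_smul₄, Finset.mul_sum, Finset.mul_sum, Finset.mul_sum]
  refine Finset.sum_congr rfl fun l _ ↦ ?_
  ring

end Algebra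

/-! ### Curvature components and positive-definiteness in a local frame -/

section LocalFrame

variable [FiniteDimensional ℝ E] [CompleteSpace E]
  (e₀ : Trivialization E (TotalSpace.proj : TangentBundle I M → M)) [MemTrivializationAtlas e₀]
  {κ : Type*} (bE : Module.Basis κ ℝ E)

/-- The curvature components `x ↦ Rm_x(sᵢ x, sⱼ x, sₖ x, sₗ x)` of a Levi-Civita connection of a
`C^∞` metric in the local frame of a trivialization are continuous on its base set
(`contMDiffOn_curvature_apply`, O'Neill 1983, Ch. 3, Lemma 3.35: `R` is a tensor field).
[cite: ONeill1983, Ch. 3, Lemma 3.35] -/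
theorem continuousOn_curvatureForm_localFrame
    {g : PseudoRiemannianMetric I ∞ E (TangentSpace I : M → Type _)} (hcov : g.IsLeviCivita cov)
    (i j k l : κ) :
    ContinuousOn (fun x ↦ g.curvatureForm cov x (e₀.localFrame bE i x) (e₀.localFrame bE j x)
      (e₀.localFrame bE k x) (e₀.localFrame bE l x)) e₀.baseSet := by
  have h1 : cov.IsLocallyContMDiff 1 := hcov.isLocallyContMDiff_one (WithTop.coe_le_coe.mpr le_top)
  have hinf : cov.IsLocallyContMDiff (⊤ : ℕ∞) := hcov.isLocallyContMDiff ⊤ (le_of_eq rfl)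
  have hs : ∀ i, CMDiff[e₀.baseSet] ∞ (T% (e₀.localFrame bE i)) := fun i ↦
    e₀.contMDiffOn_localFrame_baseSet (I := I) ∞ bE i
  have hR : CMDiff[e₀.baseSet] ∞ (T% (fun y ↦ cov.curvature y (e₀.localFrame bE i y)
      (e₀.localFrame bE j y) (e₀.localFrame bE k y))) :=
    contMDiffOn_curvature_apply h1 hinf e₀.open_baseSet (hs i) (hs j) (hs k)
  intro y hy
  have hRy := (hR y hy).contMDiffAt (e₀.open_baseSet.mem_nhds hy)
  have hly := (hs l y hy).contMDiffAt (e₀.open_baseSet.mem_nhds hy)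
  exact (g.contMDiffAt_val_apply le_rfl hRy hly).continuousAt.continuousWithinAt

omit [FiniteDimensional ℝ E] [CompleteSpace E] in
/-- **Uniform positive-definiteness on a compact set.** For a Riemannian `C^∞` metric `g` and a
compact set `K` inside the base set of a trivialization, there is `λ > 0` with
`λ ‖w‖² ≤ g_x(Σ wᵢ sᵢ x, Σ wᵢ sᵢ x)` for all `x ∈ K` and all coefficient vectors `w` (sup norm):
the continuous positive function `(x, w) ↦ g_x(Σ wᵢsᵢ, Σ wᵢsᵢ)` attains a positive minimum on
`K × {‖w‖ = 1}`. [folklore] -/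
theorem exists_pos_mul_norm_sq_le_val [Fintype κ] [T2Space M]
    {g : PseudoRiemannianMetric I ∞ E (TangentSpace I : M → Type _)} (hg : g.IsRiemannian)
    {K : Set M} (hK : IsCompact K) (hKe : K ⊆ e₀.baseSet) :
    ∃ lam : ℝ, 0 < lam ∧ ∀ x ∈ K, ∀ w : κ → ℝ,
      lam * ‖w‖ ^ 2 ≤ g.val x (∑ i, w i • e₀.localFrame bE i x) (∑ i, w i • e₀.localFrame bE i x) := by
  classical
  -- the quadratic form in coordinates
  set Q : M × (κ → ℝ) → ℝ := fun p ↦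
    g.val p.1 (∑ i, p.2 i • e₀.localFrame bE i p.1) (∑ i, p.2 i • e₀.localFrame bE i p.1) with hQ
  have hQsum : ∀ p : M × (κ → ℝ), Q p =
      ∑ i, ∑ j, p.2 i * p.2 j * g.val p.1 (e₀.localFrame bE i p.1) (e₀.localFrame bE j p.1) :=
    fun p ↦ val_sum_smul_sum_smul g p.1 p.2 p.2 _ _
  have hQcont : ContinuousOn Q (e₀.baseSet ×ˢ univ) := by
    refine ContinuousOn.congr ?_ fun p _ ↦ hQsum p
    refine continuousOn_finsetSum _ fun i _ ↦ continuousOn_finsetSum _ fun j _ ↦ ?_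
    exact (((continuous_apply i).comp continuous_snd).continuousOn.mul
      ((continuous_apply j).comp continuous_snd).continuousOn).mul
      ((contMDiffOn_gram_localFrame e₀ g bE i j).continuousOn.comp continuous_fst.continuousOn
        fun p hp ↦ hp.1)
  -- homogeneity
  have hQsmul : ∀ (x : M) (c : ℝ) (w : κ → ℝ), Q (x, c • w) = c ^ 2 * Q (x, w) := by
    intro x c w
    have : (∑ i, (c • w) i • e₀.localFrame bE i x) = c • ∑ i, w i • e₀.localFrame bE i x := by
      simp only [Pi.smul_apply, smul_eq_mul, Finset.smul_sum, smul_smul]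
    simp only [hQ]
    rw [this]; simp only [map_smul, _root_.smul_apply, smul_eq_mul]; ring
  -- positivity on nonzero coefficient vectors
  have hQpos : ∀ x ∈ e₀.baseSet, ∀ w : κ → ℝ, w ≠ 0 → 0 < Q (x, w) := by
    intro x hx w hw
    apply hg
    intro hzero
    apply hw
    have hli := (e₀.basisAt bE hx).linearIndependent
    rw [Fintype.linearIndependent_iff] at hli
    have hzero' : ∑ i, w i • (e₀.basisAt bE hx) i = 0 := by
      simpa only [e₀.localFrame_apply_of_mem_baseSet bE hx] using hzero
    funext i
    exact hli w hzero' i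
  -- degenerate cases: no coordinates, or `K = ∅`
  by_cases hκ : IsEmpty κ
  · refine ⟨1, one_pos, fun x hx w ↦ ?_⟩
    have hw : w = 0 := Subsingleton.elim _ _
    subst hw
    simp
  rw [not_isEmpty_iff] at hκ
  obtain ⟨i₀⟩ := hκ
  by_cases hKne : K.Nonempty
  swap
  · exact ⟨1, one_pos, fun x hx _ ↦ (hKne ⟨x, hx⟩).elim⟩
  obtain ⟨x₁, hx₁⟩ := hKne
  -- the compact set `K × sphere`
  set S : Set (M × (κ → ℝ)) := K ×ˢ Metric.sphere (0 : κ → ℝ) 1 with hS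
  have hScomp : IsCompact S := hK.prod (isCompact_sphere 0 1)
  have hScont : ContinuousOn Q S := hQcont.mono (prod_mono hKe (subset_univ _))
  have hSne : S.Nonempty := ⟨(x₁, Pi.single i₀ 1), hx₁, by simp [Pi.norm_single]⟩
  obtain ⟨p₀, hp₀, hmin⟩ := hScomp.exists_isMinOn hSne hScont
  have hw₀ : p₀.2 ≠ 0 := fun h0 ↦ by simpa [h0] using hp₀.2
  have hp₀pos : 0 < Q p₀ := hQpos p₀.1 (hKe hp₀.1) p₀.2 hw₀
  refine ⟨Q p₀, hp₀pos, fun x hx w ↦ ?_⟩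
  by_cases hw : w = 0
  · subst hw
    simp
  · have hnorm : 0 < ‖w‖ := norm_pos_iff.mpr hw
    set w' : κ → ℝ := ‖w‖⁻¹ • w with hw'
    have hw'S : (x, w') ∈ S := by
      refine ⟨hx, ?_⟩
      simp [hw', norm_smul, hnorm.ne']
    have hle : Q p₀ ≤ Q (x, w') := hmin hw'S
    have hQw' : Q (x, w') = (‖w‖⁻¹) ^ 2 * Q (x, w) := hQsmul x _ w
    rw [hQw'] at hle
    have := mul_le_mul_of_nonneg_right hle (sq_nonneg ‖w‖)
    calc Q p₀ * ‖w‖ ^ 2 ≤ (‖w‖⁻¹) ^ 2 * Q (x, w) * ‖w‖ ^ 2 := this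
      _ = Q (x, w) := by field_simp

end LocalFrame

/-! ### Uniform positivity of continuous curvature functionals -/

section Functional

variable [FiniteDimensional ℝ E] [CompleteSpace E] [T2Space M]
  {ι : Type*} [Fintype ι] [DecidableEq ι] {Y : Type*} [TopologicalSpace Y] [T2Space Y]
  {g : PseudoRiemannianMetric I ∞ E (TangentSpace I : M → Type _)}

/-- **Local uniform positivity of a continuous curvature functional.** Let `g` be a Riemannian
`C^∞` metric with Levi-Civita connection `cov`, `K` a compact parameter set and `F(R, y)` a
continuous function of an array `R : ι⁴ → ℝ` and of `y ∈ K`. If `F` is positive on the curvature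
components `R_{abcd} = Rm_x(e_a, e_b, e_c, e_d)` of every `g`-orthonormal `ι`-frame `e` for all
`y ∈ K`, then near every point it is bounded below by a positive constant (frames as bounded
coefficient arrays in a local frame, orthonormality a closed condition, minimum on a compact set;
see the module docstring). [folklore] -/
theorem exists_nhds_pos_le_curvatureFunctional [LocallyCompactSpace M] (hg : g.IsRiemannian)
    (hcov : g.IsLeviCivita cov) {K : Set Y} (hK : IsCompact K)
    {F : (ι → ι → ι → ι → ℝ) → Y → ℝ} (hF : ContinuousOn (uncurry F) (univ ×ˢ K))
    (hpos : ∀ (x : M) (e : ι → TangentSpace I x), g.IsOrthonormalFrame x e → ∀ y ∈ K,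
      0 < F (fun a b c d ↦ g.curvatureForm cov x (e a) (e b) (e c) (e d)) y)
    (x₀ : M) :
    ∃ U ∈ 𝓝 x₀, ∃ m : ℝ, 0 < m ∧ ∀ x ∈ U, ∀ (e : ι → TangentSpace I x),
      g.IsOrthonormalFrame x e → ∀ y ∈ K,
        m ≤ F (fun a b c d ↦ g.curvatureForm cov x (e a) (e b) (e c) (e d)) y := by
  classical
  -- the trivialization and local frame at `x₀`
  set e₀ := trivializationAt E (TangentSpace I : M → Type _) x₀ with he₀
  set bE := Module.finBasis ℝ E with hbE
  set s : Fin (Module.finrank ℝ E) → Π x : M, TangentSpace I x := e₀.localFrame bE with hsdef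
  have hx₀ : x₀ ∈ e₀.baseSet := FiberBundle.mem_baseSet_trivializationAt E _ x₀
  -- a compact neighbourhood of `x₀` inside the base set
  obtain ⟨Kx, hKx_nhds, hKx_sub, hKx_comp⟩ := local_compact_nhds (e₀.open_baseSet.mem_nhds hx₀)
  -- uniform positive-definiteness of `g` in the frame over `Kx`
  obtain ⟨lam, hlam, hlamle⟩ := exists_pos_mul_norm_sq_le_val e₀ bE hg hKx_comp hKx_sub
  have hG := fun i j ↦ (contMDiffOn_gram_localFrame e₀ g bE i j).continuousOn
  have hρ := continuousOn_curvatureForm_localFrame e₀ bE hcov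
  -- the compact parameter domain: point, bounded coefficient array, parameter
  set R : ℝ := max 1 lam⁻¹ with hR
  have hR0 : 0 ≤ R := zero_le_one.trans (le_max_left _ _)
  set D₀ : Set (M × (ι → Fin (Module.finrank ℝ E) → ℝ) × Y) :=
    Kx ×ˢ (Metric.closedBall 0 R ×ˢ K) with hD₀
  have hD₀comp : IsCompact D₀ := hKx_comp.prod ((isCompact_closedBall 0 R).prod hK)
  have hD₀closed : IsClosed D₀ := hD₀comp.isClosed
  have hD₀base : ∀ p ∈ D₀, p.1 ∈ e₀.baseSet := fun p hp ↦ hKx_sub hp.1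
  -- continuity of the coefficient projections
  have hCcont : ∀ (a : ι) (i : Fin (Module.finrank ℝ E)),
      Continuous fun p : M × (ι → Fin (Module.finrank ℝ E) → ℝ) × Y ↦ p.2.1 a i := fun a i ↦
    (continuous_apply i).comp ((continuous_apply a).comp (continuous_fst.comp continuous_snd))
  -- the Gram map `(a, b) ↦ g_x(e_a, e_b)` in coordinates
  set Gr : M × (ι → Fin (Module.finrank ℝ E) → ℝ) × Y → (ι → ι → ℝ) := fun p a b ↦
    ∑ i, ∑ j, p.2.1 a i * p.2.1 b j * g.val p.1 (s i p.1) (s j p.1) with hGr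
  have hGrcont : ContinuousOn Gr D₀ := by
    refine continuousOn_pi.2 fun a ↦ continuousOn_pi.2 fun b ↦ ?_
    refine continuousOn_finsetSum _ fun i _ ↦ continuousOn_finsetSum _ fun j _ ↦ ?_
    exact (((hCcont a i).continuousOn.mul (hCcont b j).continuousOn)).mul
      ((hG i j).comp continuous_fst.continuousOn hD₀base)
  set D : Set (M × (ι → Fin (Module.finrank ℝ E) → ℝ) × Y) :=
    D₀ ∩ Gr ⁻¹' {fun a b ↦ if a = b then (1 : ℝ) else 0} with hD
  have hDcomp : IsCompact D :=
    hD₀comp.of_isClosed_subset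
      (hGrcont.preimage_isClosed_of_isClosed hD₀closed isClosed_singleton) inter_subset_left
  -- the functional in coordinates
  set Φ : M × (ι → Fin (Module.finrank ℝ E) → ℝ) × Y → ℝ := fun p ↦
    F (fun a b c d ↦ ∑ i, ∑ j, ∑ k, ∑ l, p.2.1 a i * p.2.1 b j * p.2.1 c k * p.2.1 d l *
      g.curvatureForm cov p.1 (s i p.1) (s j p.1) (s k p.1) (s l p.1)) p.2.2 with hΦ
  have hΦcont : ContinuousOn Φ D₀ := by
    have hinner : ContinuousOn (fun p : M × (ι → Fin (Module.finrank ℝ E) → ℝ) × Y ↦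
        ((fun a b c d ↦ ∑ i, ∑ j, ∑ k, ∑ l, p.2.1 a i * p.2.1 b j * p.2.1 c k * p.2.1 d l *
          g.curvatureForm cov p.1 (s i p.1) (s j p.1) (s k p.1) (s l p.1) :
            ι → ι → ι → ι → ℝ), p.2.2)) D₀ := by
      refine ContinuousOn.prodMk ?_ (continuous_snd.comp continuous_snd).continuousOn
      refine continuousOn_pi.2 fun a ↦ continuousOn_pi.2 fun b ↦ continuousOn_pi.2 fun c ↦
        continuousOn_pi.2 fun d ↦ ?_
      refine continuousOn_finsetSum _ fun i _ ↦ continuousOn_finsetSum _ fun j _ ↦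
        continuousOn_finsetSum _ fun k _ ↦ continuousOn_finsetSum _ fun l _ ↦ ?_
      exact ((((hCcont a i).continuousOn.mul (hCcont b j).continuousOn).mul
        (hCcont c k).continuousOn).mul (hCcont d l).continuousOn).mul
        ((hρ i j k l).comp continuous_fst.continuousOn hD₀base)
    exact hF.comp hinner fun p hp ↦ ⟨mem_univ _, hp.2.2⟩
  -- points of `D` are orthonormal frames
  have hframe : ∀ p ∈ D, g.IsOrthonormalFrame p.1 (fun a ↦ ∑ i, p.2.1 a i • s i p.1) := by
    intro p hp
    have hGrp : Gr p = fun a b ↦ if a = b then (1 : ℝ) else 0 := hp.2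
    have hval : ∀ a b, g.val p.1 (∑ i, p.2.1 a i • s i p.1) (∑ j, p.2.1 b j • s j p.1) =
        if a = b then (1 : ℝ) else 0 := fun a b ↦ by
      rw [val_sum_smul_sum_smul g]
      exact congrFun (congrFun hGrp a) b
    exact ⟨fun a ↦ by simpa using hval a a, fun a b hab ↦ by simpa [hab] using hval a b⟩
  have hΦpos : ∀ p ∈ D, 0 < Φ p := by
    intro p hp
    have := hpos p.1 _ (hframe p hp) p.2.2 hp.1.2.2
    simpa only [hΦ, curvatureForm_sum_smul] using this
  -- a positive lower bound on `D`
  obtain ⟨m, hm, hmle⟩ : ∃ m : ℝ, 0 < m ∧ ∀ p ∈ D, m ≤ Φ p := by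
    by_cases hDne : D.Nonempty
    · obtain ⟨p₀, hp₀, hmin⟩ := hDcomp.exists_isMinOn hDne (hΦcont.mono inter_subset_left)
      exact ⟨Φ p₀, hΦpos p₀ hp₀, fun p hp ↦ hmin hp⟩
    · exact ⟨1, one_pos, fun p hp ↦ (hDne ⟨p, hp⟩).elim⟩
  refine ⟨Kx, hKx_nhds, m, hm, fun x hx e he y hy ↦ ?_⟩
  have hxe : x ∈ e₀.baseSet := hKx_sub hx
  -- the coefficients of `e` in the local frame
  set C : ι → Fin (Module.finrank ℝ E) → ℝ := fun a i ↦ (e₀.basisAt bE hxe).repr (e a) i with hC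
  have heC : ∀ a, (∑ i, C a i • s i x) = e a := fun a ↦ by
    simp only [hC, hsdef, e₀.localFrame_apply_of_mem_baseSet bE hxe]
    exact (e₀.basisAt bE hxe).sum_repr (e a)
  -- `(x, C, y) ∈ D`
  have hCnorm : ‖C‖ ≤ R := by
    refine (pi_norm_le_iff_of_nonneg hR0).2 fun a ↦ ?_
    have h1 : lam * ‖C a‖ ^ 2 ≤ 1 := by
      have := hlamle x hx (C a); rwa [heC a, he.1 a] at this
    by_cases hle1 : ‖C a‖ ≤ 1
    · exact hle1.trans (le_max_left _ _)
    · have hgt : 1 < ‖C a‖ := lt_of_not_ge hle1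
      have hsq : ‖C a‖ ≤ ‖C a‖ ^ 2 := by nlinarith
      have h2 : ‖C a‖ ^ 2 ≤ lam⁻¹ := by rwa [← one_div, le_div_iff₀' hlam]
      exact (hsq.trans h2).trans (le_max_right _ _)
  have hmem : (x, C, y) ∈ D := by
    refine ⟨⟨hx, mem_closedBall_zero_iff.2 hCnorm, hy⟩, ?_⟩
    show Gr (x, C, y) = fun a b ↦ if a = b then (1 : ℝ) else 0
    funext a b
    simp only [hGr]
    rw [← val_sum_smul_sum_smul g, heC a, heC b]
    by_cases hab : a = b
    · subst hab; simp [he.1 a]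
    · simp [hab, he.2 a b hab]
  have key := hmle _ hmem
  have hval : Φ (x, C, y) = F (fun a b c d ↦ g.curvatureForm cov x (e a) (e b) (e c) (e d)) y := by
    simp only [hΦ]
    congr 1
    funext a b c d
    rw [← heC a, ← heC b, ← heC c, ← heC d, curvatureForm_sum_smul]
  rwa [hval] at key

/-- **Uniform positivity of a continuous curvature functional on a compact manifold.** On a
compact Riemannian manifold, a continuous function `F(R, y)` of the curvature components
`R_{abcd} = Rm_x(e_a, e_b, e_c, e_d)` of orthonormal frames and of a parameter `y` in a compact
set `K`, positive at every orthonormal frame and every `y ∈ K`, is bounded below by a positive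
constant (finite subcover of `exists_nhds_pos_le_curvatureFunctional`) — the compactness step
"if `M⁴` is compact … there is some constant …" of Hamilton 1997, §2.1 (p. 8). [folklore] -/
theorem exists_pos_le_curvatureFunctional [CompactSpace M] [LocallyCompactSpace M]
    (hg : g.IsRiemannian) (hcov : g.IsLeviCivita cov) {K : Set Y} (hK : IsCompact K)
    {F : (ι → ι → ι → ι → ℝ) → Y → ℝ} (hF : ContinuousOn (uncurry F) (univ ×ˢ K))
    (hpos : ∀ (x : M) (e : ι → TangentSpace I x), g.IsOrthonormalFrame x e → ∀ y ∈ K,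
      0 < F (fun a b c d ↦ g.curvatureForm cov x (e a) (e b) (e c) (e d)) y) :
    ∃ m : ℝ, 0 < m ∧ ∀ (x : M) (e : ι → TangentSpace I x), g.IsOrthonormalFrame x e →
      ∀ y ∈ K, m ≤ F (fun a b c d ↦ g.curvatureForm cov x (e a) (e b) (e c) (e d)) y := by
  choose U hU m hm hle using
    fun x₀ ↦ exists_nhds_pos_le_curvatureFunctional hg hcov hK hF hpos x₀
  obtain ⟨t, -, ht⟩ := isCompact_univ.elim_nhds_subcover U fun x _ ↦ hU x
  have hcover : ∀ x : M, ∃ x₀ ∈ t, x ∈ U x₀ := fun x ↦ by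
    simpa only [mem_iUnion, exists_prop] using ht (mem_univ x)
  by_cases htne : t.Nonempty
  · refine ⟨t.inf' htne m, (Finset.lt_inf'_iff _).2 fun x _ ↦ hm x, fun x e he y hy ↦ ?_⟩
    obtain ⟨x₀, hx₀t, hxU⟩ := hcover x
    exact (Finset.inf'_le m hx₀t).trans (hle x₀ x hxU e he y hy)
  · refine ⟨1, one_pos, fun x e he y hy ↦ ?_⟩
    obtain ⟨x₀, hx₀t, -⟩ := hcover x
    exact (htne ⟨x₀, hx₀t⟩).elim

end Functional

end Literature.Geometry.Riemannian

end
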